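import Mathlib.Analysis.Real.Sqrt
import Literature.Analysis.FluidPDE.CLCutoffs
import HarnessLib

/-!
# Route EnergyDerivativeOrder · LimitTransfer — helper II: window numerics and test functions

Support lemmas for item stmt-AtomisticToContinuum-12284 (`LimitTransfer`).

* Window numerics: for `0 < a` and `|h/a − √(2/3)| ≤ 1/400` — `0 < h`, bounds on `h²`, on the
  adjacent-layer first-shell radius `a' = √(a²/3 + h²)` (`0.9979 a ≤ a' ≤ 1.00207 a`) and on the
  second-shell radius `√(4a²/3 + h²) ≥ 1.4127 a`, which is the least of the three second-shell
  bounds `3a²`, `4a²/3 + h²`, `4h²` in the window.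
* Test functions (smooth Urysohn on `ℝ`, `CL22.exists_contDiff_zero_one_of_isClosed`): a `C²`
  compactly supported `W` with `0 ≤ W ≤ 1`, `W = 1` on `[u, v]`, supported in `(u − η, v + η)`
  (`exists_shell_testFunction`); and for a set `A ⊆ ℝ` of "allowed" values a `C²` compactly
  supported `W ≥ 0` vanishing on `A` and equal to `1` at every `r ∈ [δ, L]` at distance `≥ η`
  from `A` (`exists_forbidden_testFunction`).

All `[folklore]`.
-/

noncomputable section

namespace Summit.AtomisticToContinuum.Crystallization.Theorems.EnergyDerivativeOrderLimitTransfer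

open Set Metric

/-! ## Window numerics -/

/-- `0.81649 < √(2/3) < 0.8165`. [folklore] -/
theorem sqrt_two_thirds_bounds : (0.81649 : ℝ) < √(2 / 3) ∧ √(2 / 3) < 0.8165 := by
  constructor
  · rw [Real.lt_sqrt (by norm_num)]; norm_num
  · rw [Real.sqrt_lt' (by norm_num)]; norm_num

variable {a h : ℝ}

/-- In the window, `0.81399 a ≤ h ≤ 0.819 a`; in particular `0 < h`. [folklore] -/
theorem window_h_bounds (ha : 0 < a) (hw : |h / a - √(2 / 3)| ≤ 1 / 400) :
    0.81399 * a ≤ h ∧ h ≤ 0.819 * a := by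
  obtain ⟨hs1, hs2⟩ := sqrt_two_thirds_bounds
  rw [abs_le] at hw
  obtain ⟨hw1, hw2⟩ := hw
  have h1 : (0.81399 : ℝ) ≤ h / a := by linarith
  have h2 : h / a ≤ 0.819 := by linarith
  rw [le_div_iff₀ ha] at h1
  rw [div_le_iff₀ ha] at h2
  exact ⟨h1, h2⟩

/-- In the window, `0 < h`. [folklore] -/
theorem window_h_pos (ha : 0 < a) (hw : |h / a - √(2 / 3)| ≤ 1 / 400) : 0 < h := by
  have := (window_h_bounds ha hw).1
  nlinarith

/-- In the window, `0.66257 a² ≤ h² ≤ 0.6708 a²`. [folklore] -/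
theorem window_h_sq_bounds (ha : 0 < a) (hw : |h / a - √(2 / 3)| ≤ 1 / 400) :
    0.66257 * a ^ 2 ≤ h ^ 2 ∧ h ^ 2 ≤ 0.6708 * a ^ 2 := by
  obtain ⟨h1, h2⟩ := window_h_bounds ha hw
  have h0 : 0 < h := window_h_pos ha hw
  have hl : (0.81399 * a) * (0.81399 * a) ≤ h * h := mul_self_le_mul_self (by positivity) h1
  have hu : h * h ≤ (0.819 * a) * (0.819 * a) := mul_self_le_mul_self h0.le h2
  constructor <;> nlinarith

/-- In the window, the adjacent-layer first-shell radius `a' = √(a²/3 + h²)` satisfies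
`0.9979 a ≤ a' ≤ 1.00207 a`. [folklore] -/
theorem window_aprime_bounds (ha : 0 < a) (hw : |h / a - √(2 / 3)| ≤ 1 / 400) :
    0.9979 * a ≤ √(a ^ 2 / 3 + h ^ 2) ∧ √(a ^ 2 / 3 + h ^ 2) ≤ 1.00207 * a := by
  obtain ⟨h1, h2⟩ := window_h_sq_bounds ha hw
  constructor
  · rw [Real.le_sqrt (by positivity) (by positivity)]
    nlinarith
  · rw [Real.sqrt_le_left (by positivity)]
    nlinarith

/-- In the window, `4a²/3 + h²` is the least of the three second-shell bounds and is at least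
`(1.4127 a)²`. [folklore] -/
theorem window_second_shell (ha : 0 < a) (hw : |h / a - √(2 / 3)| ≤ 1 / 400) :
    4 * a ^ 2 / 3 + h ^ 2 ≤ 3 * a ^ 2 ∧ 4 * a ^ 2 / 3 + h ^ 2 ≤ 4 * h ^ 2 ∧
      (1.4127 * a) ^ 2 ≤ 4 * a ^ 2 / 3 + h ^ 2 := by
  obtain ⟨h1, h2⟩ := window_h_sq_bounds ha hw
  refine ⟨by nlinarith, by nlinarith, by nlinarith⟩

/-- In the window, a real number whose square is at least one of the three second-shell bounds
is at least `1.4127 a` in absolute value; for a distance (non-negative) it is `≥ 1.4127 a`.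
[folklore] -/
theorem window_le_of_second_shell (ha : 0 < a) (hw : |h / a - √(2 / 3)| ≤ 1 / 400) {D : ℝ}
    (hD : 0 ≤ D)
    (hbig : 3 * a ^ 2 ≤ D ^ 2 ∨ 4 * a ^ 2 / 3 + h ^ 2 ≤ D ^ 2 ∨ 4 * h ^ 2 ≤ D ^ 2) :
    1.4127 * a ≤ D := by
  obtain ⟨h1, h2, h3⟩ := window_second_shell ha hw
  have hD2 : (1.4127 * a) ^ 2 ≤ D ^ 2 := by rcases hbig with hb | hb | hb <;> linarith
  exact (pow_le_pow_iff_left₀ (by positivity) hD two_ne_zero).1 hD2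

/-- In the window, the first-shell radii `a`, `a'` lie in `[0.9979 a, 1.00207 a]`: if
`D² = a²` or `D² = a²/3 + h²` for a non-negative `D` then `0.9979 a ≤ D ≤ 1.00207 a`. [folklore] -/
theorem window_first_shell (ha : 0 < a) (hw : |h / a - √(2 / 3)| ≤ 1 / 400) {D : ℝ} (hD : 0 ≤ D)
    (hfs : D ^ 2 = a ^ 2 ∨ D ^ 2 = a ^ 2 / 3 + h ^ 2) :
    0.9979 * a ≤ D ∧ D ≤ 1.00207 * a := by
  rcases hfs with hd | hd
  · have : D = a := by
      have := (sq_eq_sq₀ hD ha.le).1 (by rw [hd])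
      exact this
    rw [this]
    constructor <;> nlinarith
  · have : D = √(a ^ 2 / 3 + h ^ 2) := by
      rw [← hd, Real.sqrt_sq hD]
    rw [this]
    exact window_aprime_bounds ha hw

/-! ## Smooth test functions on `ℝ` -/

/-- **Shell test function**: for reals `u, v` and `η > 0` there is a `C²` compactly supported
`W : ℝ → ℝ` with `0 ≤ W ≤ 1`, `W = 1` on `[u, v]` and `W = 0` off `(u − η, v + η)`. [folklore] -/
theorem exists_shell_testFunction (u v : ℝ) {η : ℝ} (hη : 0 < η) :
    ∃ W : ℝ → ℝ, ContDiff ℝ 2 W ∧ HasCompactSupport W ∧ (∀ r, 0 ≤ W r ∧ W r ≤ 1) ∧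
      (∀ r ∈ Icc u v, W r = 1) ∧ (∀ r, W r ≠ 0 → u - η < r ∧ r < v + η) := by
  have hdisj : Disjoint (Iic (u - η) ∪ Ici (v + η)) (Icc u v) := by
    rw [Set.disjoint_left]
    rintro r (hr | hr) ⟨hru, hrv⟩
    · rw [mem_Iic] at hr; linarith
    · rw [mem_Ici] at hr; linarith
  obtain ⟨θ, hθ, h0, h1, h01⟩ :=
    Literature.Analysis.FluidPDE.CL22.exists_contDiff_zero_one_of_isClosed
      (isClosed_Iic.union isClosed_Ici) isClosed_Icc hdisj
  have hzero : ∀ r, ¬ (u - η < r ∧ r < v + η) → θ r = 0 := by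
    intro r hr
    apply h0
    rcases le_or_gt r (u - η) with h | h
    · exact Or.inl h
    · exact Or.inr (not_lt.1 fun h' => hr ⟨h, h'⟩)
  refine ⟨θ, contDiff_infty.1 hθ 2, ?_, fun r => ⟨(h01 r).1, (h01 r).2⟩, fun r hr => h1 hr,
    fun r hr => ?_⟩
  · refine HasCompactSupport.of_support_subset_isCompact (isCompact_Icc (a := u - η) (b := v + η))
      fun r hr => ?_
    by_contra hrK
    refine hr (hzero r fun h => hrK ⟨h.1.le, h.2.le⟩)
  · by_contra hcon
    exact hr (hzero r hcon)

/-- **Forbidden-value test function**: for `A ⊆ ℝ`, reals `δ, L` and `η > 0` there is a `C²`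
compactly supported `W : ℝ → ℝ` with `W ≥ 0`, `W = 0` on `A`, and `W r = 1` whenever
`δ ≤ r ≤ L` and `r` is at distance `≥ η` from every element of `A`. [folklore] -/
theorem exists_forbidden_testFunction (A : Set ℝ) (δ L : ℝ) {η : ℝ} (hη : 0 < η) :
    ∃ W : ℝ → ℝ, ContDiff ℝ 2 W ∧ HasCompactSupport W ∧ (∀ r, 0 ≤ W r) ∧
      (∀ r ∈ A, W r = 0) ∧
      (∀ r, δ ≤ r → r ≤ L → (∀ t ∈ A, η ≤ |r - t|) → W r = 1) := by
  set s : Set ℝ := closure A ∪ (Iic (δ - η) ∪ Ici (L + η)) with hs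
  set t : Set ℝ := Icc δ L ∩ ⋂ t' ∈ A, {r | η ≤ |r - t'|} with ht
  have hsc : IsClosed s := isClosed_closure.union (isClosed_Iic.union isClosed_Ici)
  have htc : IsClosed t := by
    refine isClosed_Icc.inter (isClosed_biInter fun t' _ => ?_)
    exact isClosed_le continuous_const ((continuous_id.sub continuous_const).abs)
  have hdisj : Disjoint s t := by
    rw [Set.disjoint_left]
    rintro r hr ⟨⟨hrδ, hrL⟩, hrA⟩
    simp only [mem_iInter, mem_setOf_eq] at hrA
    rcases hr with hr | hr | hr
    · obtain ⟨t', ht', hrt'⟩ := Metric.mem_closure_iff.1 hr η hη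
      have := hrA t' ht'
      rw [Real.dist_eq] at hrt'
      linarith
    · rw [mem_Iic] at hr; linarith
    · rw [mem_Ici] at hr; linarith
  obtain ⟨θ, hθ, h0, h1, h01⟩ :=
    Literature.Analysis.FluidPDE.CL22.exists_contDiff_zero_one_of_isClosed hsc htc hdisj
  refine ⟨θ, contDiff_infty.1 hθ 2, ?_, fun r => (h01 r).1,
    fun r hr => h0 (Or.inl (subset_closure hr)),
    fun r hrδ hrL hrA => h1 ⟨⟨hrδ, hrL⟩, ?_⟩⟩
  · refine HasCompactSupport.of_support_subset_isCompact (isCompact_Icc (a := δ - η) (b := L + η))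
      fun r hr => ?_
    by_contra hrK
    refine hr (h0 (Or.inr ?_))
    simp only [mem_Icc, not_and_or, not_le] at hrK
    rcases hrK with h | h
    · exact Or.inl h.le
    · exact Or.inr h.le
  · simp only [mem_iInter, mem_setOf_eq]
    exact hrA

end Summit.AtomisticToContinuum.Crystallization.Theorems.EnergyDerivativeOrderLimitTransfer

end
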